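import Summits.CriticalPhenomena.PercolationContinuityZ3.Theorems.Transplant.FKDoubleFanMultifanFinal
import Summits.CriticalPhenomena.PercolationContinuityZ3.Theorems.Transplant.FKDoubleFanOneSidedDominance
import HarnessLib

/-!
# Double fans `K₂ ∨ P_{m+1}`, far cross-apex pairs whose middle is a `b`-FAN FOLLOWED BY an `a`-FAN (pattern "BA"):
# the reduction to a four-leg inequality on `InKE⁴`, its bivector form, and the patterns "B·A·B" under (CL-a) alone

Helper file (`--supports stmt-CriticalPhenomena-4575`), FK sub-lane `prim-bschramm-fk-3` (gen 41); builds on p205010 (kernel theorem, internal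
audit signed; external expert review pending).  Pure real algebra plus measure-level corollaries; no sorries; standard axioms.
Memo `bschramm/prim-bschramm-fk-3/FAR-CROSS-XVI.md`.

`…DoubleFanMultifanFinal` (MULTIFAN₁) settled every middle in which all `a`-spokes PRECEDE all `b`-spokes (reading from the pinned `a`-spoke
`a c_j` towards the pinned `b`-spoke `b c_k`): pattern "AB".  The reversal-plus-`a ↔ b` symmetry of the pair maps "AB" to itself, so the pattern
"BA" — every middle `b`-spoke precedes every middle `a`-spoke, i.e. `w(a c_i) = 0` for `j < i ≤ ℓ` and `w(b c_i) = 0` for `ℓ < i < k` — is a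
genuinely different case, the simplest middle NOT covered by MULTIFAN₁.  Its middle word FACTORS the other way round,
`midWord q (mb ++ ma) X = fanCombo q F (fanComboB q G X)` (**`midWord_multifanBA`**), the four pinned partition functions are
**`baZ q F G u s σ τ = val_q(s ∗ BC_τ ∗ fanCombo F (fanComboB G (AC_σ ∗ u)))`** (**`crossFarZ_multifanBA`**), and negative correlation of
`(a c_j, b c_k)` for all BA middles, at every distance, in every weighted double fan, follows from the single four-leg inequality
"`baZ¹⁰baZ⁰¹ − baZ¹¹baZ⁰⁰ ≥ 0` for all `F, G, u, s ∈ InKE q`" (**`negCorr_spokes_cross_far_of_multifanBA`**) — LEMMA‴-BA, the `(b,a)` table of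
memo FAR-CROSS-XI §0(C).  In bivector form the BA Rayleigh difference is `q²·⟪∧²(fanCombo F)·imgB q G u, (s∗BC_0)∧(s∗BC_1)⟫`
(**`baZ_rayleigh_eq_pairH`**): the `a`-fan word applied to the `b`-IMAGE of the input — exactly the objects of hypothesis (CL-a) = `HypA` of
`…OneSidedDominance`.  Accordingly (CL-a) ALONE already gives more than BA: the one-sided cone `osCone q` is stable under rim steps and, under `HypA`,
under `a`-spokes (**`osCone_opE`**, **`osCone_opAC`**, the `a`-only walk **`osCone_midWord_aOnly`**), and the `b`-fan-transported targets lie in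
the dual `OSDual q` by MULTIFAN₁ itself (**`osDual_bTarget`**, from `mfRay_nonneg_inKE` and the series composition **`fanComboB_fanVecB`**); hence
(**`negCorr_spokes_cross_far_bab_of_hypA`**) under `HypA q` every middle of spoke pattern "B·A·B" (`b`-spokes, then `a`-spokes, then `b`-spokes,
rim steps anywhere; `0 < q ≤ 1`) gives a negatively correlated pair.  (`HypB` alone adds nothing to MULTIFAN₁ at this depth: the missing piece on
that side is LEMMA‴-BA again.)
[cite: Grimmett2006, §3.9 eq. (3.94) (pp. 63–64)] [folklore]
-/

noncomputable section

namespace Summit.CriticalPhenomena.PercolationContinuityZ3.Theorems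

namespace FK

namespace ThreeApex

/-! ### BA middles factor through the two fan algebras, `b`-fan first -/

/-- A `b`-only block list acts from the initial fan vector: `midWord q mb X = fanComboB (fanVecB q mb fanInit) X`. [folklore] -/
theorem midWord_oneSidedB_init (q : ℝ) {mb : List (ℝ × ℝ × ℝ)} (hb : ∀ blk ∈ mb, blk.2.1 = 0) (X : V5) :
    midWord q mb X = fanComboB q (fanVecB q mb fanInit) X := by
  have h := midWord_oneSidedB q hb fanInit X
  rwa [fanComboB_init] at h

/-- **BA middles factor**: a `b`-only list `mb` followed by an `a`-only list `ma` acts as `fanCombo F ∘ fanComboB G` with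
`G = fanVecB q mb fanInit`, `F = fanVec q ma fanInit`. [folklore] -/
theorem midWord_multifanBA (q : ℝ) {mb ma : List (ℝ × ℝ × ℝ)} (hb : ∀ blk ∈ mb, blk.2.1 = 0) (ha : ∀ blk ∈ ma, blk.2.2 = 0) (X : V5) :
    midWord q (mb ++ ma) X = fanCombo q (fanVec q ma fanInit) (fanComboB q (fanVecB q mb fanInit) X) := by
  rw [midWord_appendList, midWord_oneSidedB_init q hb X, midWord_oneSided_init q ha]

/-- **Series composition of `b`-fans**: a `b`-only block list applied after a `b`-fan is the `b`-fan of the composed fan vector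
`fanVecB q mb G` (which lies in `InKE q` when `G` does, `fanVecB_inKE`). [folklore] -/
theorem fanComboB_fanVecB (q : ℝ) {mb : List (ℝ × ℝ × ℝ)} (hb : ∀ blk ∈ mb, blk.2.1 = 0) (G V : V5) :
    fanComboB q (fanVecB q mb fanInit) (fanComboB q G V) = fanComboB q (fanVecB q mb G) V := by
  rw [← midWord_oneSidedB_init q hb, midWord_oneSidedB q hb G V]

/-! ### The four pinned partition functions of a BA middle -/

/-- **The four-leg valuation of a BA middle**: `baZ q F G u s σ τ = val_q(s ∗ BC_τ ∗ fanCombo F (fanComboB G (AC_σ ∗ u)))`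
(`G` = the `b`-fan adjacent to the pinned `a`-spoke, `F` = the `a`-fan adjacent to the pinned `b`-spoke). [folklore] -/
def baZ (q : ℝ) (F G u s : V5) (σ τ : ℝ) : ℝ :=
  val q (conv s (conv (edgeBC τ) (fanCombo q F (fanComboB q G (conv (edgeAC σ) u)))))

/-- **`crossFarZ` of a BA middle** is the four-leg valuation at the two fan vectors (last rim step absorbed into `F`). [folklore] -/
theorem crossFarZ_multifanBA (q : ℝ) {mb ma : List (ℝ × ℝ × ℝ)} (hb : ∀ blk ∈ mb, blk.2.1 = 0) (ha : ∀ blk ∈ ma, blk.2.2 = 0)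
    (rd : ℝ) (u s : V5) (σ τ : ℝ) :
    crossFarZ q (mb ++ ma) rd u s σ τ = baZ q (rimStep q rd (fanVec q ma fanInit)) (fanVecB q mb fanInit) u s σ τ := by
  simp only [crossFarZ, baZ, midWord_multifanBA q hb ha, rimStep_fanCombo]

/-- Reassociation of the target letters: `s ∗ (BC_τ ∗ X) = (s ∗ BC_τ) ∗ X`. [folklore] -/
theorem conv_conv_edgeBC_assoc (s : V5) (τ : ℝ) (X : V5) : conv s (conv (edgeBC τ) X) = conv (conv s (edgeBC τ)) X := by
  simp only [← mul_def]; ac_rfl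

/-- **Bivector form of the BA Rayleigh difference**: `baZ¹⁰baZ⁰¹ − baZ¹¹baZ⁰⁰ = q²·⟪(fanCombo F ∘ fanComboB G)(AC_0 u) ∧ (…)(AC_1 u), (s∗BC_0)∧(s∗BC_1)⟫`
— the `a`-fan word applied to the `b`-image `imgB q G u` of the input, paired with the target. [folklore] -/
theorem baZ_rayleigh_eq_pairH (q : ℝ) (F G u s : V5) :
    baZ q F G u s 1 0 * baZ q F G u s 0 1 - baZ q F G u s 1 1 * baZ q F G u s 0 0 =
      q ^ 2 * pairH q (wedgeH (fanCombo q F (fanComboB q G (conv (edgeAC 0) u))) (fanCombo q F (fanComboB q G (conv (edgeAC 1) u))))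
        (wedgeH (conv s (edgeBC 0)) (conv s (edgeBC 1))) := by
  simp only [baZ, conv_conv_edgeBC_assoc]
  exact rayleigh_eq_pairH' q _ _ _ _

open MeasureTheory Literature.Probability.LatticeModels Literature.Probability.Percolation
open scoped Classical

variable {V : Type*} [Fintype V]

section Setting

variable {a b : V} {c : ℕ → V} {m : ℕ}
variable (hab : a ≠ b) (hinj : ∀ j k, j ≤ m → k ≤ m → c j = c k → j = k) (hca : ∀ j, j ≤ m → c j ≠ a) (hcb : ∀ j, j ≤ m → c j ≠ b)
include hab hinj hca hcb

/-- **REDUCTION OF THE BA MIDDLES TO THE FOUR-LEG INEQUALITY (LEMMA‴-BA).**  If `baZ¹⁰·baZ⁰¹ − baZ¹¹·baZ⁰⁰ ≥ 0` for all `F, G, u, s ∈ InKE q`,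
then for every weighted double fan (`card V = m + 3`, weights supported on the double-fan pairs) and all `j ≤ ℓ < k ≤ m` with `w(a c_i) = 0`
for `j < i ≤ ℓ` and `w(b c_i) = 0` for `ℓ < i < k` (all middle `b`-spokes BEFORE all middle `a`-spokes), the pair `(a c_j, b c_k)` is negatively
correlated (`0 < q`). [folklore] -/
theorem negCorr_spokes_cross_far_of_multifanBA (hcard : Fintype.card V = m + 3) {q : ℝ} (hq0 : 0 < q) (w : Sym2 V → unitInterval)
    (hsupp : ∀ e, e ∉ dfPairs a b c m → w e = 0)
    (hlem : ∀ F G u s : V5, InKE q F → InKE q G → InKE q u → InKE q s →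
      0 ≤ baZ q F G u s 1 0 * baZ q F G u s 0 1 - baZ q F G u s 1 1 * baZ q F G u s 0 0)
    {j ℓ k : ℕ} (hjl : j ≤ ℓ) (hlk : ℓ < k) (hk : k ≤ m) (ha0 : ∀ i, j < i → i ≤ ℓ → w s(a, c i) = 0)
    (hb0 : ∀ i, ℓ < i → i < k → w s(b, c i) = 0) :
    (rcMeasureW w q ∅).real ({ω : BondConfig V | s(a, c j) ∈ ω} ∩ {ω | s(b, c k) ∈ ω}) ≤
      (rcMeasureW w q ∅).real {ω : BondConfig V | s(a, c j) ∈ ω} * (rcMeasureW w q ∅).real {ω : BondConfig V | s(b, c k) ∈ ω} := by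
  obtain ⟨d, rfl⟩ : ∃ d, k = j + d + 1 := ⟨k - j - 1, by omega⟩
  refine negCorr_spokes_cross_far_of_rayleigh hab hinj hca hcb hcard hq0 w hsupp hk ?_
  have huK : InKE q (conv (edgeBC (wR w s(b, c j))) (blockIn q w a b c j)) :=
    InKE.step (IsLetter.bc (w _).2.1 (w _).2.2) (inKE_blockIn q w a b c j)
  have hsK : InKE q (conv (restVec q w a b c (j + d + 1) (m - (j + d + 1))) (edgeAC (wR w s(a, c (j + d + 1))))) :=
    InKE.mul (inKE_restVec q w a b c (m - (j + d + 1)) (j + d + 1)) (by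
      rw [← mul_one (edgeAC (wR w s(a, c (j + d + 1)))), mul_def, one_def]
      exact InKE.step (IsLetter.ac (w _).2.1 (w _).2.2) InKE.base)
  obtain ⟨n, hn⟩ : ∃ n, d = (ℓ - j) + n := ⟨d - (ℓ - j), by omega⟩
  have hsplit : midBlocks w a b c j d = midBlocks w a b c j (ℓ - j) ++ midBlocks w a b c (j + (ℓ - j)) n := by
    rw [hn]; exact midBlocks_split w a b c j (ℓ - j) n
  have hxb : ∀ blk ∈ midBlocks w a b c j (ℓ - j), blk.2.1 = 0 :=
    midBlocks_aSpoke_zero w a b c j (ℓ - j) (fun i hi hi' => ha0 i hi (by omega))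
  have hya : ∀ blk ∈ midBlocks w a b c (j + (ℓ - j)) n, blk.2.2 = 0 :=
    midBlocks_bSpoke_zero w a b c (j + (ℓ - j)) n (fun i hi hi' => hb0 i (by omega) (by omega))
  have hG : InKE q (fanVecB q (midBlocks w a b c j (ℓ - j)) fanInit) :=
    fanVecB_inKE (unitBlocks_midBlocks w a b c j (ℓ - j)) (fanInit_inKE q)
  have hF : InKE q (rimStep q (wR w s(c (j + d), c (j + d + 1))) (fanVec q (midBlocks w a b c (j + (ℓ - j)) n) fanInit)) :=
    InKE.rim (w _).2.1 (w _).2.2 (fanVec_inKE (unitBlocks_midBlocks w a b c (j + (ℓ - j)) n) (fanInit_inKE q))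
  have key := hlem _ _ _ _ hF hG huK hsK
  simp only
  rw [hsplit, crossFarZ_multifanBA q hxb hya, crossFarZ_multifanBA q hxb hya, crossFarZ_multifanBA q hxb hya,
    crossFarZ_multifanBA q hxb hya]
  linarith [key]

end Setting

/-! ### (CL-a) alone: the `a`-only walk in the one-sided cone and the `b`-fan-transported targets -/

/-- The one-sided cone is stable under rim steps (unconditionally). [folklore] -/
theorem osCone_opE {q : ℝ} {β : Biv} (hβ : β ∈ osCone q) {r : ℝ} (hr0 : 0 ≤ r) (hr1 : r ≤ 1) : opE q r β ∈ osCone q :=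
  fun γ hγ => by rw [pairH_opE]; exact hβ _ (hγ.rim hr0 hr1)

/-- The one-sided cone is stable under `a`-spokes, given (CL-a). [folklore] -/
theorem osCone_opAC {q : ℝ} (hA : HypA q) {β : Biv} (hβ : β ∈ osCone q) {x : ℝ} (hx0 : 0 ≤ x) (hx1 : x ≤ 1) :
    opAC x β ∈ osCone q :=
  fun γ hγ => by rw [pairH_opAC]; exact hβ _ (hγ.ac hA hx0 hx1)

/-- **The `a`-only walk**: under (CL-a), an `a`-only block list (every `y_i = 0`) keeps a pair of vectors whose wedge lies in `osCone q`
inside `osCone q`. [folklore] -/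
theorem osCone_midWord_aOnly {q : ℝ} (hA : HypA q) :
    ∀ {ma : List (ℝ × ℝ × ℝ)}, UnitBlocks ma → (∀ blk ∈ ma, blk.2.2 = 0) →
      ∀ {X Y : V5}, wedgeH X Y ∈ osCone q → wedgeH (midWord q ma X) (midWord q ma Y) ∈ osCone q := by
  intro ma
  induction ma with
  | nil => intro _ _ X Y h; simpa [midWord] using h
  | cons blk rest ih =>
    intro hm h0 X Y h
    have hb := hm blk (by simp)
    have hrest : UnitBlocks rest := fun b hb' => hm b (by simp [hb'])
    have h0rest : ∀ b ∈ rest, b.2.2 = 0 := fun b hb' => h0 b (by simp [hb'])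
    have hy : blk.2.2 = 0 := h0 blk (by simp)
    simp only [midWord, hy, conv_edgeBC_zero]
    refine ih hrest h0rest ?_
    rw [← opAC_wedgeH]
    refine osCone_opAC hA ?_ hb.2.2.1 hb.2.2.2.1
    rw [← opE_wedgeH]
    exact osCone_opE h hb.1 hb.2.1

/-- `mfZ` through the reversed `b`-fan word: `mfZ q F G w s σ τ = val_q(fanComboBrev G (s ∗ BC_τ) ∗ fanCombo F (AC_σ ∗ w))`. [folklore] -/
theorem mfZ_eq_brev (q : ℝ) (F G w s : V5) (σ τ : ℝ) :
    mfZ q F G w s σ τ = val q (conv (fanComboBrev q G (conv s (edgeBC τ))) (fanCombo q F (conv (edgeAC σ) w))) := by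
  simp only [mfZ, conv_conv_edgeBC_assoc, val_conv_fanComboB]

/-- **The `b`-fan-transported targets lie in the dual** (`0 < q ≤ 1`): for a `b`-only block list `mb`, a last rim weight `rd ∈ [0,1]` and
`s ∈ InKE q`, with `G₂ = E_{rd}(fanVecB q mb fanInit)`, the bivector `(fanComboBrev G₂ (s∗BC_0)) ∧ (fanComboBrev G₂ (s∗BC_1))` pairs
non-negatively with every `imgA` (this IS MULTIFAN₁, `mfRay_nonneg_inKE`) and with every `imgB` (series composition of `b`-fans and LEMMA′'s
mirror). [folklore] -/
theorem osDual_bTarget {q : ℝ} (hq0 : 0 < q) (hq1 : q ≤ 1) {mb : List (ℝ × ℝ × ℝ)} (hmb : UnitBlocks mb) (hb : ∀ blk ∈ mb, blk.2.1 = 0)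
    {rd : ℝ} (hrd0 : 0 ≤ rd) (hrd1 : rd ≤ 1) {s : V5} (hs : InKE q s) :
    OSDual q (wedgeH (fanComboBrev q (rimStep q rd (fanVecB q mb fanInit)) (conv s (edgeBC 0)))
      (fanComboBrev q (rimStep q rd (fanVecB q mb fanInit)) (conv s (edgeBC 1)))) := by
  set G₂ := rimStep q rd (fanVecB q mb fanInit) with hG₂
  have hG₂K : InKE q G₂ := InKE.rim hrd0 hrd1 (fanVecB_inKE hmb (fanInit_inKE q))
  have hq2 : (0 : ℝ) < q ^ 2 := pow_pos hq0 2
  refine ⟨fun F w hF hw => ?_, fun G w hG hw => ?_⟩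
  · -- MULTIFAN₁
    have key := mfRay_nonneg_inKE hq0 hq1 F G₂ w s hF hG₂K hw hs
    rw [mfZ_eq_brev, mfZ_eq_brev, mfZ_eq_brev, mfZ_eq_brev, rayleigh_eq_pairH'] at key
    simp only [imgA]
    exact (mul_nonneg_iff_of_pos_left hq2).mp key
  · -- two `b`-fans in series
    have hG'' : InKE q (rimStep q rd (fanVecB q mb G)) := InKE.rim hrd0 hrd1 (fanVecB_inKE hmb hG)
    have hser : ∀ V : V5, fanComboB q G₂ (fanComboB q G V) = fanComboB q (rimStep q rd (fanVecB q mb G)) V := by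
      intro V
      rw [hG₂, ← rimStep_fanComboB, fanComboB_fanVecB q hb, rimStep_fanComboB]
    have e : ∀ σ τ : ℝ, val q (conv (fanComboBrev q G₂ (conv s (edgeBC τ))) (fanComboB q G (conv (edgeAC σ) w))) =
        val q (conv (conv s (edgeBC τ)) (fanComboB q (rimStep q rd (fanVecB q mb G)) (conv (edgeAC σ) w))) := by
      intro σ τ; rw [← val_conv_fanComboB, hser]
    have key := (target_osDual hq0 hq1 hs).2 _ w hG'' hw
    have id := rayleigh_eq_pairH' q (fanComboB q G (conv (edgeAC 0) w)) (fanComboB q G (conv (edgeAC 1) w))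
      (fanComboBrev q G₂ (conv s (edgeBC 0))) (fanComboBrev q G₂ (conv s (edgeBC 1)))
    have id2 := rayleigh_eq_pairH' q (fanComboB q (rimStep q rd (fanVecB q mb G)) (conv (edgeAC 0) w))
      (fanComboB q (rimStep q rd (fanVecB q mb G)) (conv (edgeAC 1) w)) (conv s (edgeBC 0)) (conv s (edgeBC 1))
    rw [e, e, e, e] at id
    simp only [imgB] at key ⊢
    have h3 : q ^ 2 * pairH q (wedgeH (fanComboB q G (conv (edgeAC 0) w)) (fanComboB q G (conv (edgeAC 1) w)))
        (wedgeH (fanComboBrev q G₂ (conv s (edgeBC 0))) (fanComboBrev q G₂ (conv s (edgeBC 1)))) =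
        q ^ 2 * pairH q (wedgeH (fanComboB q (rimStep q rd (fanVecB q mb G)) (conv (edgeAC 0) w))
          (fanComboB q (rimStep q rd (fanVecB q mb G)) (conv (edgeAC 1) w))) (wedgeH (conv s (edgeBC 0)) (conv s (edgeBC 1))) := by
      rw [← id, ← id2]
    have h4 : 0 ≤ q ^ 2 * pairH q (wedgeH (fanComboB q G (conv (edgeAC 0) w)) (fanComboB q G (conv (edgeAC 1) w)))
        (wedgeH (fanComboBrev q G₂ (conv s (edgeBC 0))) (fanComboBrev q G₂ (conv s (edgeBC 1)))) := by
      rw [h3]; exact mul_nonneg hq2.le key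
    exact (mul_nonneg_iff_of_pos_left hq2).mp h4

section Setting

variable {a b : V} {c : ℕ → V} {m : ℕ}
variable (hab : a ≠ b) (hinj : ∀ j k, j ≤ m → k ≤ m → c j = c k → j = k) (hca : ∀ j, j ≤ m → c j ≠ a) (hcb : ∀ j, j ≤ m → c j ≠ b)
include hab hinj hca hcb

/-- **(CL-a) ALONE ⟹ NEGATIVE CORRELATION FOR EVERY MIDDLE OF SPOKE PATTERN "B·A·B".**  If `HypA q` holds at `q ∈ (0,1]`, then for every
weighted double fan (`card V = m + 3`, weights supported on the double-fan pairs) and all `j ≤ ℓ₁ ≤ ℓ₂ < k ≤ m` with `w(a c_i) = 0` for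
`j < i ≤ ℓ₁`, `w(b c_i) = 0` for `ℓ₁ < i ≤ ℓ₂` and `w(a c_i) = 0` for `ℓ₂ < i < k` (middle `b`-spokes, then `a`-spokes, then `b`-spokes), the
pair `(a c_j, b c_k)` is negatively correlated.  (`ℓ₂ = k − 1`: the BA middles; `ℓ₁ = j`: MULTIFAN₁.) [folklore] -/
theorem negCorr_spokes_cross_far_bab_of_hypA (hcard : Fintype.card V = m + 3) {q : ℝ} (hq0 : 0 < q) (hq1 : q ≤ 1)
    (w : Sym2 V → unitInterval) (hsupp : ∀ e, e ∉ dfPairs a b c m → w e = 0) (hA : HypA q)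
    {j ℓ₁ ℓ₂ k : ℕ} (hj1 : j ≤ ℓ₁) (h12 : ℓ₁ ≤ ℓ₂) (h2k : ℓ₂ < k) (hk : k ≤ m)
    (ha1 : ∀ i, j < i → i ≤ ℓ₁ → w s(a, c i) = 0) (hb2 : ∀ i, ℓ₁ < i → i ≤ ℓ₂ → w s(b, c i) = 0)
    (ha3 : ∀ i, ℓ₂ < i → i < k → w s(a, c i) = 0) :
    (rcMeasureW w q ∅).real ({ω : BondConfig V | s(a, c j) ∈ ω} ∩ {ω | s(b, c k) ∈ ω}) ≤
      (rcMeasureW w q ∅).real {ω : BondConfig V | s(a, c j) ∈ ω} * (rcMeasureW w q ∅).real {ω : BondConfig V | s(b, c k) ∈ ω} := by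
  obtain ⟨d, rfl⟩ : ∃ d, k = j + d + 1 := ⟨k - j - 1, by omega⟩
  refine negCorr_spokes_cross_far_of_rayleigh hab hinj hca hcb hcard hq0 w hsupp hk ?_
  have huK : InKE q (conv (edgeBC (wR w s(b, c j))) (blockIn q w a b c j)) :=
    InKE.step (IsLetter.bc (w _).2.1 (w _).2.2) (inKE_blockIn q w a b c j)
  have hsK : InKE q (conv (restVec q w a b c (j + d + 1) (m - (j + d + 1))) (edgeAC (wR w s(a, c (j + d + 1))))) :=
    InKE.mul (inKE_restVec q w a b c (m - (j + d + 1)) (j + d + 1)) (by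
      rw [← mul_one (edgeAC (wR w s(a, c (j + d + 1)))), mul_def, one_def]
      exact InKE.step (IsLetter.ac (w _).2.1 (w _).2.2) InKE.base)
  -- split the middle block list into the three runs
  set n₁ := ℓ₁ - j with hn₁
  set n₂ := ℓ₂ - ℓ₁ with hn₂
  obtain ⟨n₃, hn₃⟩ : ∃ n₃, d = (n₁ + n₂) + n₃ := ⟨d - (n₁ + n₂), by omega⟩
  have hsplit : midBlocks w a b c j d =
      (midBlocks w a b c j n₁ ++ midBlocks w a b c (j + n₁) n₂) ++ midBlocks w a b c (j + (n₁ + n₂)) n₃ := by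
    rw [hn₃, midBlocks_split w a b c j (n₁ + n₂) n₃, midBlocks_split w a b c j n₁ n₂]
  have hx1 : ∀ blk ∈ midBlocks w a b c j n₁, blk.2.1 = 0 :=
    midBlocks_aSpoke_zero w a b c j n₁ (fun i hi hi' => ha1 i hi (by omega))
  have hy2 : ∀ blk ∈ midBlocks w a b c (j + n₁) n₂, blk.2.2 = 0 :=
    midBlocks_bSpoke_zero w a b c (j + n₁) n₂ (fun i hi hi' => hb2 i (by omega) (by omega))
  have hx3 : ∀ blk ∈ midBlocks w a b c (j + (n₁ + n₂)) n₃, blk.2.1 = 0 :=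
    midBlocks_aSpoke_zero w a b c (j + (n₁ + n₂)) n₃ (fun i hi hi' => ha3 i (by omega) (by omega))
  set mb₁ := midBlocks w a b c j n₁
  set ma := midBlocks w a b c (j + n₁) n₂
  set mb₂ := midBlocks w a b c (j + (n₁ + n₂)) n₃
  set rd := wR w s(c (j + d), c (j + d + 1))
  set u := conv (edgeBC (wR w s(b, c j))) (blockIn q w a b c j)
  set s := conv (restVec q w a b c (j + d + 1) (m - (j + d + 1))) (edgeAC (wR w s(a, c (j + d + 1))))
  have hrd0 : 0 ≤ rd := (w _).2.1
  have hrd1 : rd ≤ 1 := (w _).2.2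
  set G₁ := fanVecB q mb₁ fanInit
  set G₂ := rimStep q rd (fanVecB q mb₂ fanInit)
  have hG₁ : InKE q G₁ := fanVecB_inKE (unitBlocks_midBlocks w a b c j n₁) (fanInit_inKE q)
  -- the four pinned partition functions as pairings `val(Y_τ ∗ X_σ)`
  set X : ℝ → V5 := fun σ => midWord q ma (fanComboB q G₁ (conv (edgeAC σ) u))
  set Y : ℝ → V5 := fun τ => fanComboBrev q G₂ (conv s (edgeBC τ))
  have hZ : ∀ σ τ : ℝ, crossFarZ q (midBlocks w a b c j d) rd u s σ τ = val q (conv (Y τ) (X σ)) := by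
    intro σ τ
    simp only [crossFarZ, hsplit, midWord_appendList, X, Y]
    rw [midWord_oneSidedB_init q hx1, midWord_oneSidedB_init q hx3, rimStep_fanComboB, conv_conv_edgeBC_assoc, val_conv_fanComboB]
  -- the input side: `X 0 ∧ X 1 ∈ osCone` by the `a`-only walk from `imgB G₁ u`
  have hmem : wedgeH (X 0) (X 1) ∈ osCone q :=
    osCone_midWord_aOnly hA (unitBlocks_midBlocks w a b c (j + n₁) n₂) hy2 (imgB_mem_osCone hG₁ huK)
  -- the target side: `Y 0 ∧ Y 1 ∈ OSDual`
  have hdual : OSDual q (wedgeH (Y 0) (Y 1)) :=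
    osDual_bTarget hq0 hq1 (unitBlocks_midBlocks w a b c (j + (n₁ + n₂)) n₃) hx3 hrd0 hrd1 hsK
  have hpos : ∀ β, β ∈ osCone q → 0 ≤ pairH q β (wedgeH (Y 0) (Y 1)) := fun β hβ => hβ _ hdual
  have key := rayleigh_of_isOpCone hmem hpos
  have e : ∀ A B : V5, conv A B = conv B A := fun A B => by simp only [← mul_def]; ac_rfl
  simp only
  rw [hZ, hZ, hZ, hZ, e (Y 1) (X 1), e (Y 0) (X 0), e (Y 0) (X 1), e (Y 1) (X 0)]
  linarith [key]

end Setting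

end ThreeApex

end FK

end Summit.CriticalPhenomena.PercolationContinuityZ3.Theorems
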